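import Mathlib.GroupTheory.Sylow
import Mathlib.GroupTheory.IndexNormal
import Mathlib.Data.Nat.Prime.Pow
import HarnessLib

/-!
# Descent along a cyclic tower in a finite `p`-group (Serre, *Corps locaux* IX §1–2)

A finite `p`-group `Q` has a chain `1 = C₀ ⊲ C₁ ⊲ ⋯ ⊲ C_N = Q` with `C_{i+1}/C_i ≅ ℤ/p`
(Sylow: a subgroup of order `p^n` lies in the group and has index `p`, the least prime factor
of `|C_{i+1}|`, hence is normal).  We record this as an **induction principle on subgroups**
(`IsPGroup.subgroup_induction`): a property of subgroups that holds for `⊥` and passes from a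
normal subgroup of index `p` to the group holds for `⊤`.  It drives the dévissage
"`H²` of a `p`-extension vanishes layer by cyclic layer" in the proof of Serre II §3.1 Prop. 5
(`Literature.NumberTheory.GaloisRepresentations.tsen_fieldCdLE_one_of_trdeg_eq_one`).

## References

* J.-P. Serre, *Corps locaux* (1968), IX §1 (dévissage des `p`-groupes). [SerreLocalFields1979]
-/

namespace Literature.NumberTheory.GaloisRepresentations

/-- **Induction on the subgroups of a finite `p`-group along cyclic layers**: if `Φ ⊥` and `Φ`
passes from `C'` to `C` whenever `C' ≤ C` is normal in `C` of index `p`, then `Φ ⊤`.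
[cite: SerreLocalFields1979, IX §1] -/
theorem IsPGroup.subgroup_induction {p : ℕ} [hp : Fact p.Prime] {Q : Type*} [Group Q] [Finite Q]
    (hQ : IsPGroup p Q) (Φ : Subgroup Q → Prop) (h0 : Φ ⊥)
    (hstep : ∀ C C' : Subgroup Q, C' ≤ C → (C'.subgroupOf C).Normal → C'.relIndex C = p →
      Φ C' → Φ C) :
    Φ ⊤ := by
  suffices key : ∀ (n : ℕ) (C : Subgroup Q), Nat.card C = p ^ n → Φ C by
    obtain ⟨N, hN⟩ := IsPGroup.iff_card.1 hQ
    exact key N ⊤ (by rw [Subgroup.card_top, hN])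
  intro n
  induction n with
  | zero =>
    intro C hC
    rw [pow_zero, Subgroup.card_eq_one] at hC
    exact hC ▸ h0
  | succ n ih =>
    intro C hC
    -- a subgroup `K` of `C` of order `p ^ n`, of index `p`, hence normal
    have hdvd : p ^ n ∣ Nat.card C := hC ▸ pow_dvd_pow p n.le_succ
    obtain ⟨K, hK⟩ := Sylow.exists_subgroup_card_pow_prime p hdvd
    have hKi : K.index = p := by
      have h := Subgroup.card_mul_index K
      rw [hK, hC, pow_succ] at h
      exact mul_left_cancel₀ (pow_ne_zero n hp.out.ne_zero) h
    have hKn : K.Normal :=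
      Subgroup.normal_of_index_eq_minFac_card (by rw [hKi, hC, hp.out.pow_minFac n.succ_ne_zero])
    -- push `K` into `Q`
    have hle : K.map C.subtype ≤ C := Subgroup.map_subtype_le K
    have hKC : (K.map C.subtype).subgroupOf C = K := by
      rw [← Subgroup.comap_subtype, Subgroup.comap_map_eq_self_of_injective C.subtype_injective]
    have hKn' : ((K.map C.subtype).subgroupOf C).Normal := by rwa [hKC]
    refine hstep C (K.map C.subtype) hle hKn' ?_ (ih _ ?_)
    · change ((K.map C.subtype).subgroupOf C).index = p
      rw [hKC, hKi]
    · rw [← hK]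
      exact Nat.card_congr (K.equivMapOfInjective C.subtype C.subtype_injective).toEquiv.symm

end Literature.NumberTheory.GaloisRepresentations
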